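import Summits.ResolutionOfSingularities.ResolutionOfSingularities.Theorems.FrobeniusLadderFInjectiveMacaulayficationPConePrimeCarrier
import Mathlib.Algebra.CharP.Lemmas
import HarnessLib

/-!
# `f_cusp` IN THE FAN'S VARIABLE ORDER, AND ITS 4-NOMIAL FORM `z² + w⁵ + x⁶ + y⁹` AT `p = 3`: INTEGRAL, NO COORDINATE VANISHES ON IT
# (crux `FrobeniusLadder.FInjectiveMacaulayfication` stmt-ResolutionOfSingularities-15315, chain w45a, hole #3β, road (β) of the (iv) memo
# `L/res-L1-w45a-stub-2/SCOPING-fcusp-iv.md` §0 «ONE small file FcuspChar3Form»; seat res-L1-w45a-stub-2)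

[OURS · L1 W4.5a] AI-written; AI review is weaker than expert review. NOT a statement of any manuscript; no named fact.

idea-2's fan `Σ = Σ₁ ∧ Σ₂` for the specimen `f_cusp` lives in `ℤ⁴` with coordinates `(x, y, z, w)` (`L/res-L1-w45a-idea-2/r5/kh3cusp3.json`,
key "3": `F = z² + w⁵ + x⁶ + y⁹`, `monomial_map` in `x,y,z,w`), so the road-B fan instance (`CICertificates.ciCertificates` /
`RoadBFrame`, `n = 4`, `r = 1`) wants the hypersurface in the variable order `(x,y,z,w) = (X 0, X 1, X 2, X 3)`:
`F' = X 2² + X 3⁵ + (X 0² + X 1³)³` (any characteristic) and, IN CHARACTERISTIC `3` where the cube is additive, the 4-NOMIAL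
`F = X 2² + X 3⁵ + X 0⁶ + X 1⁹ = F'`. The landed `PConePrimeCarrier` (p505774) proves primality and `x̄ᵥ ≠ 0` for the same polynomial in
the order `(z,x,y,w)`, `G = X 0² + X 3⁵ + (X 1² + X 2³)³`; this file transports along the reindexing `σ = (0 1)(1 2)` (`σ 0 = 2, σ 1 = 0,
σ 2 = 1, σ 3 = 3`, `rename σ G = F'`):

* `rename_G` — `rename σ G = F'`; `prime_F'` — `F'` is prime and divides no variable (any field);
* `F_eq_F'_char3` — `X 2² + X 3⁵ + X 0⁶ + X 1⁹ = F'` for `char k = 3`;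
* `fcusp_prime_and_X_ne_zero_range` (any field, `Fs 0 = F'`) and `fcusp3_prime_and_X_ne_zero_range` (`char k = 3`, `Fs 0 = F`) — the
  `hprime` / `hXne` inputs of `CICertificates.ciCertificates` / `RoadBFrame.originPointFixable_of_hon` in the `Ideal.span (Set.range Fs)` form;
* `fcusp3_constantCoeff` — `F(0) = 0` (the frame's `hf0`).

No definitions, no named facts. [folklore]
-/

set_option linter.dupNamespace false

noncomputable section

open MvPolynomial

namespace Summit.ResolutionOfSingularities.ResolutionOfSingularities.Theorems.FInjectiveMacaulayfication.FcuspChar3Form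

open Summit.ResolutionOfSingularities.ResolutionOfSingularities.Theorems.FInjectiveMacaulayfication

variable (k : Type) [Field k]

/-! ## §1 The reindexing `(z,x,y,w) → (x,y,z,w)` -/

/-- **`rename σ G = F'`** for `σ = (0 1)(1 2)`: `σ 0 = 2`, `σ 1 = 0`, `σ 2 = 1`, `σ 3 = 3`. [folklore] -/
theorem rename_G : MvPolynomial.rename ((Equiv.swap (0 : Fin 4) 1).trans (Equiv.swap (1 : Fin 4) 2))
      (X 0 ^ 2 + X 3 ^ 5 + (X 1 ^ 2 + X 2 ^ 3) ^ 3 : MvPolynomial (Fin 4) k) =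
    X 2 ^ 2 + X 3 ^ 5 + (X 0 ^ 2 + X 1 ^ 3) ^ 3 := by
  have h0 : ((Equiv.swap (0 : Fin 4) 1).trans (Equiv.swap (1 : Fin 4) 2)) 0 = 2 := by decide
  have h1 : ((Equiv.swap (0 : Fin 4) 1).trans (Equiv.swap (1 : Fin 4) 2)) 1 = 0 := by decide
  have h2 : ((Equiv.swap (0 : Fin 4) 1).trans (Equiv.swap (1 : Fin 4) 2)) 2 = 1 := by decide
  have h3 : ((Equiv.swap (0 : Fin 4) 1).trans (Equiv.swap (1 : Fin 4) 2)) 3 = 3 := by decide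
  simp only [map_add, map_pow, MvPolynomial.rename_X, h0, h1, h2, h3]

/-- **`F' = z² + w⁵ + (x²+y³)³` (order `(x,y,z,w)`) is prime in `k[x,y,z,w]` and divides no variable**, any field (transport of
`PConePrimeCarrier.g_irreducible` / `mk_Y_ne_zero` / `mk_X_succ_ne_zero` along `rename σ`). [folklore] -/
theorem prime_F' (F' : MvPolynomial (Fin 4) k) (hF' : F' = X 2 ^ 2 + X 3 ^ 5 + (X 0 ^ 2 + X 1 ^ 3) ^ 3) :
    Prime F' ∧ ∀ v : Fin 4, ¬ F' ∣ MvPolynomial.X v := by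
  set σ : Fin 4 ≃ Fin 4 := (Equiv.swap (0 : Fin 4) 1).trans (Equiv.swap (1 : Fin 4) 2) with hσ
  set G : MvPolynomial (Fin 4) k := X 0 ^ 2 + X 3 ^ 5 + (X 1 ^ 2 + X 2 ^ 3) ^ 3 with hG
  have hGp : Prime G := (PConePrimeCarrier.g_irreducible G hG).prime
  have he : MvPolynomial.renameEquiv k σ G = F' := by
    rw [hF', ← rename_G k]; rfl
  refine ⟨?_, fun v => ?_⟩
  · rw [← he]
    exact (MulEquiv.prime_iff (MvPolynomial.renameEquiv k σ).toMulEquiv).mpr hGp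
  · -- `F' ∣ X v` would give `G ∣ X (σ⁻¹ v)`, i.e. `x̄_{σ⁻¹ v} = 0` in `k[Y,x,y,w]/(G)`
    intro hdvd
    have hdvd' : G ∣ MvPolynomial.X (σ.symm v) := by
      have h1 := map_dvd (MvPolynomial.renameEquiv k σ).symm hdvd
      rw [← he, AlgEquiv.symm_apply_apply] at h1
      have h2 : (MvPolynomial.renameEquiv k σ).symm (MvPolynomial.X v : MvPolynomial (Fin 4) k) = MvPolynomial.X (σ.symm v) := by
        show MvPolynomial.rename σ.symm (MvPolynomial.X v : MvPolynomial (Fin 4) k) = _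
        rw [MvPolynomial.rename_X]
      rwa [h2] at h1
    have hne : Ideal.Quotient.mk (Ideal.span {G}) (MvPolynomial.X (σ.symm v)) ≠ 0 := by
      rcases Fin.eq_zero_or_eq_succ (σ.symm v) with h0 | ⟨j, hj⟩
      · rw [h0]; exact PConePrimeCarrier.mk_Y_ne_zero G hG
      · rw [hj]; exact PConePrimeCarrier.mk_X_succ_ne_zero G hG j
    exact hne (by rw [Ideal.Quotient.eq_zero_iff_mem, Ideal.mem_span_singleton]; exact hdvd')

/-! ## §2 Characteristic `3`: the 4-nomial form -/

/-- **`z² + w⁵ + x⁶ + y⁹ = z² + w⁵ + (x²+y³)³` when `char k = 3`** (the cube is additive). [folklore] -/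
theorem F_eq_F'_char3 [CharP k 3] :
    (X 2 ^ 2 + X 3 ^ 5 + X 0 ^ 6 + X 1 ^ 9 : MvPolynomial (Fin 4) k) = X 2 ^ 2 + X 3 ^ 5 + (X 0 ^ 2 + X 1 ^ 3) ^ 3 := by
  have h3 : (3 : MvPolynomial (Fin 4) k) = 0 := by
    have := CharP.cast_eq_zero (MvPolynomial (Fin 4) k) 3
    simpa using this
  linear_combination (-(X 0 ^ 4 * X 1 ^ 3 + X 0 ^ 2 * X 1 ^ 6)) * h3

/-- `F(0) = 0`: the 4-nomial vanishes at the origin (the frame's `hf0`). [folklore] -/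
theorem fcusp3_constantCoeff (F : MvPolynomial (Fin 4) k) (hF : F = X 2 ^ 2 + X 3 ^ 5 + X 0 ^ 6 + X 1 ^ 9) :
    constantCoeff F = 0 := by
  subst hF
  simp [constantCoeff_X]

/-- `F'(0) = 0`. [folklore] -/
theorem fcusp_constantCoeff (F' : MvPolynomial (Fin 4) k) (hF' : F' = X 2 ^ 2 + X 3 ^ 5 + (X 0 ^ 2 + X 1 ^ 3) ^ 3) :
    constantCoeff F' = 0 := by
  subst hF'
  simp [constantCoeff_X]

/-! ## §3 Packaged for `Fs : Fin 1 → k[X]` (the `hprime` / `hXne` binders of the road-B frame) -/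

/-- `Set.range` of a `Fin 1`-family. [folklore] -/
theorem span_range_eq (Fs : Fin 1 → MvPolynomial (Fin 4) k) : Ideal.span (Set.range Fs) = Ideal.span {Fs 0} := by
  have hrange : Set.range Fs = {Fs 0} := by
    ext q
    simp only [Set.mem_range, Set.mem_singleton_iff]
    constructor
    · rintro ⟨i, rfl⟩; rw [Subsingleton.elim i 0]
    · rintro rfl; exact ⟨0, rfl⟩
  rw [hrange]

/-- **`f_cusp` inputs `hprime` / `hXne`, any field**: for `Fs 0 = F' = X 2² + X 3⁵ + (X 0² + X 1³)³`, `Ideal.span (Set.range Fs)` is prime and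
every `x̄ᵥ ≠ 0`. [folklore] -/
theorem fcusp_prime_and_X_ne_zero_range (Fs : Fin 1 → MvPolynomial (Fin 4) k)
    (hF : Fs 0 = X 2 ^ 2 + X 3 ^ 5 + (X 0 ^ 2 + X 1 ^ 3) ^ 3) :
    (Ideal.span (Set.range Fs)).IsPrime ∧
      ∀ v : Fin 4, Ideal.Quotient.mk (Ideal.span (Set.range Fs)) (MvPolynomial.X v) ≠ 0 := by
  obtain ⟨hp, hX⟩ := prime_F' k (Fs 0) hF
  rw [span_range_eq]
  refine ⟨(Ideal.span_singleton_prime hp.ne_zero).mpr hp, fun v => ?_⟩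
  rw [Ne, Ideal.Quotient.eq_zero_iff_mem, Ideal.mem_span_singleton]
  exact hX v

/-- **`f_cusp/𝔽₃` inputs `hprime` / `hXne` in the 4-NOMIAL form**: for `char k = 3` and `Fs 0 = F = X 2² + X 3⁵ + X 0⁶ + X 1⁹`,
`Ideal.span (Set.range Fs)` is prime and every `x̄ᵥ ≠ 0`. [folklore] -/
theorem fcusp3_prime_and_X_ne_zero_range [CharP k 3] (Fs : Fin 1 → MvPolynomial (Fin 4) k)
    (hF : Fs 0 = X 2 ^ 2 + X 3 ^ 5 + X 0 ^ 6 + X 1 ^ 9) :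
    (Ideal.span (Set.range Fs)).IsPrime ∧
      ∀ v : Fin 4, Ideal.Quotient.mk (Ideal.span (Set.range Fs)) (MvPolynomial.X v) ≠ 0 :=
  fcusp_prime_and_X_ne_zero_range k Fs (hF.trans (F_eq_F'_char3 k))

/-- The same for the literal singleton family `![F]` (the form `RoadBFrame.originPointFixable_of_hon` takes), `char k = 3`. [folklore] -/
theorem fcusp3_prime_and_X_ne_zero_vec [CharP k 3] (F : MvPolynomial (Fin 4) k) (hF : F = X 2 ^ 2 + X 3 ^ 5 + X 0 ^ 6 + X 1 ^ 9) :
    (Ideal.span (Set.range (![F] : Fin 1 → MvPolynomial (Fin 4) k))).IsPrime ∧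
      ∀ v : Fin 4, Ideal.Quotient.mk (Ideal.span (Set.range (![F] : Fin 1 → MvPolynomial (Fin 4) k))) (MvPolynomial.X v) ≠ 0 :=
  fcusp3_prime_and_X_ne_zero_range k ![F] hF

end Summit.ResolutionOfSingularities.ResolutionOfSingularities.Theorems.FInjectiveMacaulayfication.FcuspChar3Form

end
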